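import Summits.QuantumFields.BalabanUV.Beta.FP.StepLawWardGeneric
import Summits.QuantumFields.BalabanUV.Beta.FP.PerfectKernelSymmGeneric
import Summits.QuantumFields.BalabanUV.Beta.FP.RoadRebasedHoldsBm
import Summits.QuantumFields.BalabanUV.Beta.SpineRootedBmN

/-!
# `BalabanUV.Beta.FP.RoadPinnedBmEnd` — road «FP» for binder row D1, claim-table row BM-PINS (owner ruling R-FP-13 (d)), sibling of the owner's
# `FP.RoadPinnedBm` (p225747): the generic END PINNED AT THE BLOCK-MEAN ROOTED FAMILY OF RECORD `SpineRooted.JsBalBmNAtOf … = dressBmAt hr ∘ JsBal0NAtOf …`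
# with its `m = 1` names — closed form, the `hTsymm` supplier, the (STEP)+(ASYMP) form, the K-SIDE DISCHARGED at the adopted units through row BM-ROWS,
# the cell's END statement by type, and the centred-root literal of an2's `hR` wirings

HONEST FRAMING (cell contract, verbatim): «discharging `BetaPertH` makes Bałaban's UV stability UNCONDITIONAL — a real constructive-QFT
result; it is NOT the continuum limit and NOT the Clay problem.»  THIS MODULE PROVES NO ESTIMATE: it instantiates the owner's dressing-agnostic ENDs
(`RoadEndGeneric.d1Drift_of_generic_step_law_bounded`, and — through gan24 leaf-02-g32's `RoadRebasedHoldsBm` — `StepLawWardGeneric.d1Drift_dressBmAt_…`)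
at ONE literal, an2's block-mean co-dressed spine over the NATIVE-placement undressed family `SpineRooted.JsBalBmNAtOf hLc hr cE cVH cΛ W Cw δw hδw hW`
(`SpineRootedBmN`; the family of an2's `hR` wirings `SpineRootedBmNReduced` ∕ `…Assembly` at the centred root), with the `m = 1` members of the four slots
DISPLAYED BY NAME: A-∕K-slot `G₁ j := coDressKBmAt (toSite r) Lc (KInvStep Lc j)` (an2 `TbalOf_dressBmAt`), stencil slot `(JsBal0NAtOf … j).S` (`S0NAt …` at
`j = 0`, `SstepNAt … (j+1)` after; any presentation `Sfl` with `hSfl` accepted), table slot the SUPPLIED tables `W j` (`JsBal0NAtOf_W`).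
RELATION TO THE OWNER's `FP.RoadPinnedBm.d1Drift_JsBalBmNAtOf_of_ward_explicitDefect` (p225747; the same literal, ANY units, K-rows in lane G-an2-4's
ENTRYWISE currency as HYPOTHESES, `hTsymm` discharged): that theorem is NOT restated here.  THIS file adds (§1) the four-family closed form of the literal,
(§2) the binder `hTsymm` as a NAMED supplier and the (STEP)+(ASYMP) form of the END, (§3) the END with the K-SIDE DISCHARGED BY NAME at the adopted units
`sfStep Lc` ∕ `smStep 3 Lc` — row G-an2-4's K-slot rows, the window and the class data `hGinf` all supplied through row BM-ROWS (`RoadRebasedHoldsBm`,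
`G := GBm r Lc`) — so that the residual is EXACTLY {pins, S-rows on the native stencils, W-rows on `W`, `hSinf`∕`hWinf`, the Ward row `hWf` of the flipped
perfect one-step kernel (row HH-INHERIT-G), (Wt) `hWt` + bond-swap symmetry `hWsymm` of `W` (what is left of `hTsymm`, row TGEN-SWAP: the K-shape row and
(St♭) of the native stencils are an2's tree theorems), `hSDF` (REBASE-J + (SDF)), `hasym` (N7)}, plus the cell's END statement BY TYPE from that list, and
(§4) the CENTRED-ROOT literal.  Every analytic statement stays a HYPOTHESIS or is a landed supplier's theorem used BY NAME.  The (R45)∕(P6) ruling on the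
wall LITERAL is the β-leads', NOT made here.  NOT «D1 closed», NEVER «G-an2-4 closed», NOT BetaPertH, NOT continuum, NOT Clay; 0∕4 row-D1 binders
(hW, hR, D1Tel, D1Rep); not in print — our bookkeeping.
ABSOLUTE RULE (cell, verbatim): «No internally-minted statement may enter as a cited fact. Every hypothesis is either kernel-proved in this
package or a verbatim quotation of a PUBLISHED theorem with page reference.»  Nothing is cited; 0 `def`; no `def … : Prop`; every input is a tree
theorem used BY NAME; nothing of the owner's, an2's or row BM-ROWS' is restated.
HONEST DEPENDENCY (verbatim): «continuum YM on T⁴ ⇐ BetaPertH ∧ nine spine estimates (0/9 proved); BetaPertH ⇐ (D1) ∧ (D4) ∧ CAP+tail;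
G-an2-4 gates asym, D1 and NE2/3/4.»

CONTENT.
* §1 `JsBalBmNAtOf_eq_dressBmAt` (the family of record IS the block-mean rooted instance `dressBmAt hr ∘ Js⁰`, `rfl`); the four-family CLOSED FORM
  `TbalOf_JsBalBmNAtOf` ∕ `TbalOf_JsBalBmNAtOf_of_presentation`: `TbalOf Lc (JsBalBmNAtOf …) j = hessKer (G₁ j) (vertexOfK (G₁ j) Lc (Js⁰ j).S) (W j)`.
* §2 (any in-block root `r`, any nonzero units `sf`, `sm`, free (j, m)-families `G`, `S`, `Wt` pinned at `m = 1`):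
  **`hTsymm_JsBalBmNAtOf`** — the END's binder `hTsymm` for the pinned family ⟸ {class data at `m = 1`, (Wt) + bond-swap symmetry of the supplied
  tables} (the owner's `PerfectKernelSymmGeneric.hTsymm_TGenOf_one`, row TGEN-SWAP, with the K-shape row := an2's `shiftK_coDressKBmAt_KInvStep` and
  (St♭) := an2's `SpineRooted.JsBal0NAtOf_S_translate`, both BY NAME);
  **`d1Drift_JsBalBmNAtOf_of_step_law_bounded`** (`RoadEndGeneric` §2 at the literal: residual {co-dressed K-rows, S-∕W-rows at `m = 1`, (STEP), (ASYMP)}).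
* §3 (adopted units, `G := GBm r Lc`, any in-block root): THE K-SIDE DISCHARGED by row BM-ROWS (gan24 leaf-02-g32's
  `RoadRebasedHoldsBm.d1Drift_dressBmAt_of_slots_…`; K-rows ∕ window ∕ `hGinf` from row G-an2-4 BY NAME): **`d1Drift_JsBalBmNAtOf_of_slots_step_law_bounded`**,
  **`d1Drift_JsBalBmNAtOf_of_slots_ward_explicitDefect`** (residual {S-rows on the native stencils, W-rows on `W`, `hSinf`, `hWinf`, `hWf`, `hWt`, `hWsymm`,
  `hSDF`, `hasym`}), **`endpointExistence_JsBalBmNAtOf_of_slots_ward_explicitDefect`** (the cell's END statement BY TYPE + `hβ` + (D4) + (C) + `hgen`).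
* §4 the CENTRED-ROOT literal of an2's `hR` wirings (odd `Lc`, `hr := ctrOff_mem_box hLc.pos`), §3 there: **`d1Drift_JsBalBmNAtOf_ctr_of_slots_ward_explicitDefect`**.
Provenance: pub-balaban β sub-cell, unit `b2b-balaban-gan24-formalise-leaf-01` gen 42 (idle G-an2-4 swarm leaf seat, cross-lane bookkeeping for road FP;
row BM-PINS CLAIMED 2026-08-20T15:58:23Z; sibling option (C) of the owner's collision resolution, journal 16:19:50Z), 2026-08-20 (v1); no existing file
touched.  [our object], 0 `def`, 0 cite, 0 sorry.
-/

namespace Summit.QuantumFields.BalabanUV.Beta.FP.RoadPinnedBmEnd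

open Filter Topology
open Literature.MathematicalPhysics.QuantumFieldTheory.Balaban1983to89
open Literature.MathematicalPhysics.QuantumFieldTheory.Balaban1983to89.Beta
open FlowStep FlowStepRuns DagBinding
open B12Beta (secondMoment)
open B12Normalization (stepBal)
open DressedMomentNormalisation (dressedEntry)
open ExpKernelCalculus (MKer Decays VertexFamily₂ hessKer shiftK)
open PolarizationSign (WardTransversal)
open OneStepResolventKernel (Fib LocStencil JetData)
open OneStepKernelFamily (vertexOfK KInvStep TbalOf flipK D1Drift endpointExistence_of_D1Drift)
open AffineAveraging (box toSite)
open AveragingContoursRooted (ctrOff ctrOff_mem_box)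
open Literature.MathematicalPhysics.QuantumFieldTheory.Balaban1983to89.Beta.RemainderChain (RemainderConst)
open Summit.QuantumFields.BalabanUV.Beta.HessKerDressedUnits (unitK unitS unitW)
open Summit.QuantumFields.BalabanUV.Beta.AxialDressingRooted (dressBmAt coDressKBmAt TbalOf_dressBmAt shiftK_coDressKBmAt_KInvStep)
open Summit.QuantumFields.BalabanUV.Beta.SpineRooted (JsBal0NAtOf JsBal0NAtOf_W JsBal0NAtOf_S_translate JsBalBmNAtOf)
open Summit.QuantumFields.BalabanUV.Beta.GAN24.CombesThomas (sfStep smStep sfStep_ne_zero smStep_ne_zero)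
open Summit.QuantumFields.BalabanUV.Beta.FP.PerfectObjectsT (KPerf SPerfOf WPerfOf)
open Summit.QuantumFields.BalabanUV.Beta.FP.TransportInfinityM (colOf)
open Summit.QuantumFields.BalabanUV.Beta.FP.StepDefectInherit (defect)
open Summit.QuantumFields.BalabanUV.Beta.FP.RoadEndGeneric (KPerfOf TGenOf fPerfG d1Drift_of_generic_step_law_bounded)
open Summit.QuantumFields.BalabanUV.Beta.FP.PerfectKernelSymmGeneric (hTsymm_TGenOf_one)
open Summit.QuantumFields.BalabanUV.Beta.FP.RoadRebasedHoldsBm (GBm GBm_one hGinf_GBm_holds d1Drift_dressBmAt_of_slots_step_law_bounded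
  d1Drift_dressBmAt_of_slots_ward_symm_explicitDefect)

noncomputable section

variable {Lc : ℕ} [NeZero Lc]

/-! ## §1 The family of record and its four-family closed form -/

section Family

variable (hLc : 1 ≤ Lc) {r : Fin (3 + 1) → ℕ} (hr : r ∈ box (3 + 1) Lc) (cE cVH cΛ : ℝ)
  (W : ℕ → Fin (3 + 1) → (Fin (3 + 1) → ℤ) → Fin (3 + 1) → (Fin (3 + 1) → ℤ) → MKer (3 + 1) (Fib 3))
  (Cw' δw : ℕ → ℝ) (hδw : ∀ j, 0 < δw j) (hW' : ∀ j, VertexFamily₂ (W j) Lc (Cw' j) (δw j))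

/-- [our object] **THE FAMILY OF RECORD IS THE BLOCK-MEAN ROOTED INSTANCE**: an2's co-dressed native spine `JsBalBmNAtOf …` is
`fun j ↦ dressBmAt hr (JsBal0NAtOf … j)` — the shape `dressBmAt hr ∘ Js⁰` of `RoadEndGeneric` §4 ∕ `StepLawWardGeneric` §3 — by `rfl`. -/
theorem JsBalBmNAtOf_eq_dressBmAt :
    JsBalBmNAtOf (d := 3) hLc hr cE cVH cΛ W Cw' δw hδw hW' = fun j => dressBmAt hr (JsBal0NAtOf (d := 3) hLc hr cE cVH cΛ W Cw' δw hδw hW' j) :=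
  rfl

/-- [our object] **THE FOUR-FAMILY CLOSED FORM OF THE FAMILY OF RECORD** (`m = 1` names displayed): for every `j`,
`TbalOf Lc (JsBalBmNAtOf …) j = hessKer (G₁ j) (vertexOfK (G₁ j) Lc (JsBal0NAtOf … j).S) (W j)` with `G₁ j := coDressKBmAt (toSite r) Lc (KInvStep Lc j)`
— an2's `TbalOf_dressBmAt` (co-dressed resolvents, UNDRESSED jets) with the table slot read as the SUPPLIED `W j` (`JsBal0NAtOf_W`). -/
theorem TbalOf_JsBalBmNAtOf (j : ℕ) :
    TbalOf Lc (JsBalBmNAtOf (d := 3) hLc hr cE cVH cΛ W Cw' δw hδw hW') j =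
      hessKer (coDressKBmAt (toSite r) Lc (KInvStep (d := 3) Lc j))
        (vertexOfK (coDressKBmAt (toSite r) Lc (KInvStep (d := 3) Lc j)) Lc (JsBal0NAtOf (d := 3) hLc hr cE cVH cΛ W Cw' δw hδw hW' j).S)
        (W j) := by
  have h := TbalOf_dressBmAt hr (JsBal0NAtOf (d := 3) hLc hr cE cVH cΛ W Cw' δw hδw hW') j
  rw [JsBal0NAtOf_W] at h
  exact h

/-- [our object] The closed form on ANY presentation `Sfl` of the native undressed stencils (`hSfl`; e.g. `S0NAt …`∕`SstepNAt … (j+1)`). -/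
theorem TbalOf_JsBalBmNAtOf_of_presentation {Sfl : ℕ → Fin (3 + 1) → (Fin (3 + 1) → ℤ) → MKer (3 + 1) (Fib 3)}
    (hSfl : ∀ j, (JsBal0NAtOf (d := 3) hLc hr cE cVH cΛ W Cw' δw hδw hW' j).S = Sfl j) (j : ℕ) :
    TbalOf Lc (JsBalBmNAtOf (d := 3) hLc hr cE cVH cΛ W Cw' δw hδw hW') j =
      hessKer (coDressKBmAt (toSite r) Lc (KInvStep (d := 3) Lc j))
        (vertexOfK (coDressKBmAt (toSite r) Lc (KInvStep (d := 3) Lc j)) Lc (Sfl j)) (W j) := by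
  rw [TbalOf_JsBalBmNAtOf, hSfl]

end Family

/-! ## §2 Road FP's END pinned at the family of record: any root, any units, free (j, m)-families pinned at `m = 1` -/

section End

variable (hLc : 1 ≤ Lc) {r : Fin (3 + 1) → ℕ} (hr : r ∈ box (3 + 1) Lc) (cE cVH cΛ : ℝ)
  (W : ℕ → Fin (3 + 1) → (Fin (3 + 1) → ℤ) → Fin (3 + 1) → (Fin (3 + 1) → ℤ) → MKer (3 + 1) (Fib 3))
  (Cw' δw : ℕ → ℝ) (hδw : ∀ j, 0 < δw j) (hW' : ∀ j, VertexFamily₂ (W j) Lc (Cw' j) (δw j))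
  {Sfl : ℕ → Fin (3 + 1) → (Fin (3 + 1) → ℤ) → MKer (3 + 1) (Fib 3)} (sf sm : ℕ → ℝ)
  (G : ℕ → ℕ → MKer (3 + 1) (Fib 3)) (S : ℕ → ℕ → Fin (3 + 1) → (Fin (3 + 1) → ℤ) → MKer (3 + 1) (Fib 3))
  (Wt : ℕ → ℕ → Fin (3 + 1) → (Fin (3 + 1) → ℤ) → Fin (3 + 1) → (Fin (3 + 1) → ℤ) → MKer (3 + 1) (Fib 3))
  {R C cK δK Cs cS δS Cw cW δW θ : ℝ}

/-- **THE END's BINDER `hTsymm` FOR THE PINNED FAMILY — (St♭) AND THE K-SHAPE ROW DISCHARGED BY NAME** (any root, any units): the transposition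
symmetry `TGenOf Lc (KPerfOf … G 1) (KPerfOf … G 1) (SPerfOf … S 1) (WPerfOf … Wt 1) a b t = (same) b a (−t)` of the perfect one-step kernel of the
pinned (j, m)-families ⟸ {class data of the perfect `m = 1` resolvent and stencil (`hGinf1`, `hSinf1` — the END's own `hGinf 1` / `hSinf 1`), (Wt) `hWt`
and bond-swap symmetry `hWsymm` of the SUPPLIED tables `W`} — the owner's `PerfectKernelSymmGeneric.hTsymm_TGenOf_one` (row TGEN-SWAP) with the coarse
invariance of the co-dressed resolvents := an2's `shiftK_coDressKBmAt_KInvStep` and (St♭) of the native undressed stencils := an2's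
`SpineRooted.JsBal0NAtOf_S_translate` (every member, every root).  [our object] -/
theorem hTsymm_JsBalBmNAtOf (hSfl : ∀ j, (JsBal0NAtOf (d := 3) hLc hr cE cVH cΛ W Cw' δw hδw hW' j).S = Sfl j)
    (hG1 : ∀ j, G j 1 = coDressKBmAt (toSite r) Lc (KInvStep (d := 3) Lc j)) (hS1 : ∀ j, S j 1 = Sfl j) (hW1 : ∀ j, Wt j 1 = W j)
    (hGinf1 : ∃ δ C : ℝ, 0 < δ ∧ 0 ≤ C ∧ Decays (KPerfOf (d := 3) sf sm G 1) C δ)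
    (hSinf1 : ∃ Cs δS : ℝ, 0 < δS ∧ LocStencil (SPerfOf sf sm S 1) Cs δS)
    (hWt : ∀ (j : ℕ) (μ : Fin (3 + 1)) (y : Fin (3 + 1) → ℤ) (ν : Fin (3 + 1)) (y' t : Fin (3 + 1) → ℤ),
      W j μ (y + t) ν (y' + t) = shiftK (-((Lc : ℤ) • t)) (W j μ y ν y'))
    (hWsymm : ∀ (j : ℕ) (μ : Fin (3 + 1)) (y : Fin (3 + 1) → ℤ) (ν : Fin (3 + 1)) (y' : Fin (3 + 1) → ℤ), W j μ y ν y' = W j ν y' μ y)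
    (a b : Fin (3 + 1)) (t : Fin (3 + 1) → ℤ) :
    TGenOf Lc (KPerfOf sf sm G 1) (KPerfOf sf sm G 1) (SPerfOf sf sm S 1) (WPerfOf sf sm Wt 1) a b t
      = TGenOf Lc (KPerfOf sf sm G 1) (KPerfOf sf sm G 1) (SPerfOf sf sm S 1) (WPerfOf sf sm Wt 1) b a (-t) := by
  obtain ⟨δ, C', hδ, -, hG⟩ := hGinf1
  obtain ⟨Cs', δs, hδs, hSi⟩ := hSinf1
  exact hTsymm_TGenOf_one sf sm G G S Wt (A1 := fun j => coDressKBmAt (toSite r) Lc (KInvStep (d := 3) Lc j))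
    (G1 := fun j => coDressKBmAt (toSite r) Lc (KInvStep (d := 3) Lc j)) (S1 := Sfl) (W1 := W) hG1 hG1 hS1 hW1 hG hδ
    ⟨δ, C', hδ, hG.nonneg (Sum.inl 0), hG⟩ hSi hδs (fun j t => shiftK_coDressKBmAt_KInvStep (d := 3) (toSite r) j t)
    (fun j t => shiftK_coDressKBmAt_KInvStep (d := 3) (toSite r) j t)
    (fun j κ u t => by rw [← hSfl]; exact JsBal0NAtOf_S_translate hLc hr cE cVH cΛ W Cw' δw hδw hW' j κ u t) hWt hWsymm a b t

/-- **ROAD «FP», THE END PINNED AT THE BLOCK-MEAN ROOTED FAMILY OF RECORD (bounded-defect (STEP)+(ASYMP) form).**  For an2's co-dressed native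
spine `JsBalBmNAtOf hLc hr cE cVH cΛ W Cw δw hδw hW` (any in-block root `r`), any presentation `Sfl` of its undressed stencils, any nonzero units and
ANY (j, m)-families `(G, S, Wt)` with `m = 1` members `(coDressKBmAt (toSite r) Lc (KInvStep Lc j), Sfl j, W j)`: Cauchy-currency rows on the rescaled
co-dressed resolvents (row BM-ROWS' currency), on the rescaled native stencils and on the rescaled supplied tables, (STEP) + (ASYMP) for
`fPerfG Lc sf sm G G S Wt μ ν` ⊢ `D1Drift Lc (JsBalBmNAtOf …) N μ ν` — the owner's `RoadEndGeneric.d1Drift_of_generic_step_law_bounded` with the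
closed form of §1.  Discharges nothing by itself. [our object] -/
theorem d1Drift_JsBalBmNAtOf_of_step_law_bounded (hsf : ∀ j, sf j ≠ 0) (hsm : ∀ j, sm j ≠ 0)
    (hSfl : ∀ j, (JsBal0NAtOf (d := 3) hLc hr cE cVH cΛ W Cw' δw hδw hW' j).S = Sfl j)
    (hG1 : ∀ j, G j 1 = coDressKBmAt (toSite r) Lc (KInvStep (d := 3) Lc j)) (hS1 : ∀ j, S j 1 = Sfl j) (hW1 : ∀ j, Wt j 1 = W j)
    (hK : ∀ j, Decays (unitK (sf j) (sm j) (coDressKBmAt (toSite r) Lc (KInvStep (d := 3) Lc j))) C δK)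
    (hKall : ∀ k j, Decays (unitK (sf (k + j)) (sm (k + j)) (coDressKBmAt (toSite r) Lc (KInvStep (d := 3) Lc (k + j))) -
      unitK (sf k) (sm k) (coDressKBmAt (toSite r) Lc (KInvStep (d := 3) Lc k))) (cK * θ ^ k) δK)
    (hS : ∀ j, LocStencil (unitS (sf j) (sm j) (Sfl j)) Cs δS)
    (hSall : ∀ k j, LocStencil (unitS (sf (k + j)) (sm (k + j)) (Sfl (k + j)) - unitS (sf k) (sm k) (Sfl k)) (cS * θ ^ k) δS)
    (hW : ∀ j, VertexFamily₂ (unitW (sf j) (sm j) (W j)) Lc Cw δW)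
    (hWall : ∀ k j, VertexFamily₂ (unitW (sf (k + j)) (sm (k + j)) (W (k + j)) - unitW (sf k) (sm k) (W k)) Lc (cW * θ ^ k) δW)
    (hR : 0 < R) (hRK : R < δK) (hRS : R / 2 < δS) (hRW : R < δW) (hθ0 : 0 ≤ θ) (hθ1 : θ < 1) (μ ν : Fin 4) {N Cg : ℝ}
    (hstep : ∀ m : ℕ, 1 ≤ m →
      fPerfG Lc sf sm G G S Wt μ ν (m + 1) = fPerfG Lc sf sm G G S Wt μ ν m + fPerfG Lc sf sm G G S Wt μ ν 1)
    (hasym : ∀ m : ℕ, 1 ≤ m → |fPerfG Lc sf sm G G S Wt μ ν m - (m : ℝ) * stepBal N Lc| ≤ Cg) :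
    D1Drift Lc (JsBalBmNAtOf (d := 3) hLc hr cE cVH cΛ W Cw' δw hδw hW') N μ ν :=
  d1Drift_of_generic_step_law_bounded (JsBalBmNAtOf (d := 3) hLc hr cE cVH cΛ W Cw' δw hδw hW') sf sm G G S Wt
    (A1 := fun j => coDressKBmAt (toSite r) Lc (KInvStep (d := 3) Lc j)) (G1 := fun j => coDressKBmAt (toSite r) Lc (KInvStep (d := 3) Lc j))
    (S1 := Sfl) (W1 := W) hsf hsm (TbalOf_JsBalBmNAtOf_of_presentation hLc hr cE cVH cΛ W Cw' δw hδw hW' hSfl) hG1 hG1 hS1 hW1 hK hKall hK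
    hKall hS hSall hW hWall hR hRK hRS hRW hθ0 hθ1 μ ν hstep hasym

end End

/-! ## §3 The K-side DISCHARGED by row BM-ROWS (`FP.RoadRebasedHoldsBm`): adopted units, `G := GBm r Lc`, any in-block root -/

section Slots

variable (hLc : 1 ≤ Lc) {r : Fin (3 + 1) → ℕ} (hr : r ∈ box (3 + 1) Lc) (cE cVH cΛ : ℝ)
  (W : ℕ → Fin (3 + 1) → (Fin (3 + 1) → ℤ) → Fin (3 + 1) → (Fin (3 + 1) → ℤ) → MKer (3 + 1) (Fib 3))
  (Cw' δw : ℕ → ℝ) (hδw : ∀ j, 0 < δw j) (hW' : ∀ j, VertexFamily₂ (W j) Lc (Cw' j) (δw j))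
  (S : ℕ → ℕ → Fin (3 + 1) → (Fin (3 + 1) → ℤ) → MKer (3 + 1) (Fib 3))
  (Wt : ℕ → ℕ → Fin (3 + 1) → (Fin (3 + 1) → ℤ) → Fin (3 + 1) → (Fin (3 + 1) → ℤ) → MKer (3 + 1) (Fib 3))
  {Cs cS δS θS Cw cW δW θW : ℝ}

/-- **ROAD «FP», THE END PINNED AT THE FAMILY OF RECORD WITH THE K-SIDE DISCHARGED (bounded-defect (STEP)+(ASYMP) form)** (`d = 3`, `2 ≤ Lc`, any
in-block root `r`, adopted units `sfStep Lc` ∕ `smStep 3 Lc`, resolvent families `G := GBm r Lc` of row BM-ROWS): `D1Drift Lc (JsBalBmNAtOf …) N μ ν` ⟸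
{pins `hS1`∕`hW1`, the S-slot Cauchy rows of the rescaled native stencils and the W-slot Cauchy rows of the rescaled supplied tables (each at its own rate),
(STEP) + (ASYMP) for `fPerfG … (GBm r Lc) (GBm r Lc) S Wt`} — gan24 leaf-02-g32's `RoadRebasedHoldsBm.d1Drift_dressBmAt_of_slots_step_law_bounded` (K-rows,
window and units from row G-an2-4 BY NAME) at `Js⁰ := JsBal0NAtOf …`, tables read as `W j` (`JsBal0NAtOf_W`).  NOT «D1 closed». [our object] -/
theorem d1Drift_JsBalBmNAtOf_of_slots_step_law_bounded (hLc2 : 2 ≤ Lc)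
    (hS1 : ∀ j, S j 1 = (JsBal0NAtOf (d := 3) hLc hr cE cVH cΛ W Cw' δw hδw hW' j).S) (hW1 : ∀ j, Wt j 1 = W j)
    (hS : ∀ j, LocStencil (unitS (sfStep Lc j) (smStep 3 Lc j) (JsBal0NAtOf (d := 3) hLc hr cE cVH cΛ W Cw' δw hδw hW' j).S) Cs δS)
    (hSall : ∀ k j, LocStencil (unitS (sfStep Lc (k + j)) (smStep 3 Lc (k + j))
        (JsBal0NAtOf (d := 3) hLc hr cE cVH cΛ W Cw' δw hδw hW' (k + j)).S -
      unitS (sfStep Lc k) (smStep 3 Lc k) (JsBal0NAtOf (d := 3) hLc hr cE cVH cΛ W Cw' δw hδw hW' k).S) (cS * θS ^ k) δS)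
    (hW : ∀ j, VertexFamily₂ (unitW (sfStep Lc j) (smStep 3 Lc j) (W j)) Lc Cw δW)
    (hWall : ∀ k j, VertexFamily₂ (unitW (sfStep Lc (k + j)) (smStep 3 Lc (k + j)) (W (k + j)) - unitW (sfStep Lc k) (smStep 3 Lc k) (W k)) Lc
      (cW * θW ^ k) δW)
    (hδS : 0 < δS) (hδW : 0 < δW) (hθS0 : 0 ≤ θS) (hθS1 : θS < 1) (hθW0 : 0 ≤ θW) (hθW1 : θW < 1) (μ ν : Fin 4) {N Cg : ℝ}
    (hstep : ∀ m : ℕ, 1 ≤ m →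
      fPerfG Lc (sfStep Lc) (smStep 3 Lc) (GBm r Lc) (GBm r Lc) S Wt μ ν (m + 1) =
        fPerfG Lc (sfStep Lc) (smStep 3 Lc) (GBm r Lc) (GBm r Lc) S Wt μ ν m + fPerfG Lc (sfStep Lc) (smStep 3 Lc) (GBm r Lc) (GBm r Lc) S Wt μ ν 1)
    (hasym : ∀ m : ℕ, 1 ≤ m → |fPerfG Lc (sfStep Lc) (smStep 3 Lc) (GBm r Lc) (GBm r Lc) S Wt μ ν m - (m : ℝ) * stepBal N Lc| ≤ Cg) :
    D1Drift Lc (JsBalBmNAtOf (d := 3) hLc hr cE cVH cΛ W Cw' δw hδw hW') N μ ν :=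
  d1Drift_dressBmAt_of_slots_step_law_bounded hr (JsBal0NAtOf (d := 3) hLc hr cE cVH cΛ W Cw' δw hδw hW') S Wt hLc2 hS1
    (fun j => (hW1 j).trans (JsBal0NAtOf_W hLc hr cE cVH cΛ W Cw' δw hδw hW' j).symm) hS hSall
    (fun j => by rw [JsBal0NAtOf_W]; exact hW j) (fun k j => by rw [JsBal0NAtOf_W, JsBal0NAtOf_W]; exact hWall k j)
    hδS hδW hθS0 hθS1 hθW0 hθW1 μ ν hstep hasym

/-- **ROAD «FP», THE END PINNED AT THE FAMILY OF RECORD WITH THE K-SIDE AND `hTsymm` DISCHARGED — residual {S-rows, W-rows, hSinf, hWinf, hWf, (Wt),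
bond-swap, hSDF, hasym}** (`d = 3`, `2 ≤ Lc`, any in-block root `r`, adopted units, `G := GBm r Lc`): `D1Drift Lc (JsBalBmNAtOf hLc hr cE cVH cΛ W Cw δw hδw hW) N μ ν`
⟸ EXACTLY {pins `hS1`∕`hW1`; the S-slot Cauchy rows of the rescaled NATIVE stencils `(JsBal0NAtOf … j).S` and the W-slot Cauchy rows of the rescaled
SUPPLIED tables `W j` (each at its own rate); the S-∕W-side class data `hSinf`∕`hWinf` (`m ≥ 1`); the Ward row **`hWf`** of the flipped perfect one-step
kernel (row HH-INHERIT-G); (Wt) **`hWt`** and bond-swap symmetry **`hWsymm`** of `W` (what is left of `hTsymm`); **`hSDF`**; **`hasym`** (N7)} — gan24 leaf-02-g32's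
`RoadRebasedHoldsBm.d1Drift_dressBmAt_of_slots_ward_symm_explicitDefect` (K-rows `hK`∕`hKall`, window, units and class data `hGinf` from row G-an2-4 BY NAME)
with `hTsymm := hTsymm_JsBalBmNAtOf` (§2; its `hGinf 1` := `RoadRebasedHoldsBm.hGinf_GBm_holds`).  NOT «D1 closed»; 0∕4 row-D1 binders. [our object] -/
theorem d1Drift_JsBalBmNAtOf_of_slots_ward_explicitDefect (hLc2 : 2 ≤ Lc)
    (hS1 : ∀ j, S j 1 = (JsBal0NAtOf (d := 3) hLc hr cE cVH cΛ W Cw' δw hδw hW' j).S) (hW1 : ∀ j, Wt j 1 = W j)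
    (hS : ∀ j, LocStencil (unitS (sfStep Lc j) (smStep 3 Lc j) (JsBal0NAtOf (d := 3) hLc hr cE cVH cΛ W Cw' δw hδw hW' j).S) Cs δS)
    (hSall : ∀ k j, LocStencil (unitS (sfStep Lc (k + j)) (smStep 3 Lc (k + j))
        (JsBal0NAtOf (d := 3) hLc hr cE cVH cΛ W Cw' δw hδw hW' (k + j)).S -
      unitS (sfStep Lc k) (smStep 3 Lc k) (JsBal0NAtOf (d := 3) hLc hr cE cVH cΛ W Cw' δw hδw hW' k).S) (cS * θS ^ k) δS)
    (hW : ∀ j, VertexFamily₂ (unitW (sfStep Lc j) (smStep 3 Lc j) (W j)) Lc Cw δW)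
    (hWall : ∀ k j, VertexFamily₂ (unitW (sfStep Lc (k + j)) (smStep 3 Lc (k + j)) (W (k + j)) - unitW (sfStep Lc k) (smStep 3 Lc k) (W k)) Lc
      (cW * θW ^ k) δW)
    (hδS : 0 < δS) (hδW : 0 < δW) (hθS0 : 0 ≤ θS) (hθS1 : θS < 1) (hθW0 : 0 ≤ θW) (hθW1 : θW < 1)
    (hSinf : ∀ m : ℕ, 1 ≤ m → ∃ Cs' δS' : ℝ, 0 < δS' ∧ LocStencil (SPerfOf (sfStep Lc) (smStep 3 Lc) S m) Cs' δS')
    (hWinf : ∀ m : ℕ, 1 ≤ m → ∃ Cw'' δW' : ℝ, 0 < δW' ∧ VertexFamily₂ (WPerfOf (sfStep Lc) (smStep 3 Lc) Wt m) (Lc ^ m) Cw'' δW')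
    (hWf : WardTransversal (flipK (TGenOf Lc (KPerfOf (sfStep Lc) (smStep 3 Lc) (GBm r Lc) 1) (KPerfOf (sfStep Lc) (smStep 3 Lc) (GBm r Lc) 1)
      (SPerfOf (sfStep Lc) (smStep 3 Lc) S 1) (WPerfOf (sfStep Lc) (smStep 3 Lc) Wt 1))))
    (hWt : ∀ (j : ℕ) (μ : Fin (3 + 1)) (y : Fin (3 + 1) → ℤ) (ν : Fin (3 + 1)) (y' t : Fin (3 + 1) → ℤ),
      W j μ (y + t) ν (y' + t) = shiftK (-((Lc : ℤ) • t)) (W j μ y ν y'))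
    (hWsymm : ∀ (j : ℕ) (μ : Fin (3 + 1)) (y : Fin (3 + 1) → ℤ) (ν : Fin (3 + 1)) (y' : Fin (3 + 1) → ℤ), W j μ y ν y' = W j ν y' μ y)
    (μ ν : Fin 4)
    (hSDF : ∀ m : ℕ, 1 ≤ m → secondMoment (defect
      (fun m => TGenOf (Lc ^ m) (KPerfOf (sfStep Lc) (smStep 3 Lc) (GBm r Lc) m) (KPerfOf (sfStep Lc) (smStep 3 Lc) (GBm r Lc) m)
        (SPerfOf (sfStep Lc) (smStep 3 Lc) S m) (WPerfOf (sfStep Lc) (smStep 3 Lc) Wt m))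
      (fun m a b z => ((Lc ^ m : ℕ) : ℝ) ^ 8 * dressedEntry (colOf (KPerf (d := 3) Lc (sfStep Lc) (smStep 3 Lc) m))
        (TGenOf Lc (KPerfOf (sfStep Lc) (smStep 3 Lc) (GBm r Lc) 1) (KPerfOf (sfStep Lc) (smStep 3 Lc) (GBm r Lc) 1)
          (SPerfOf (sfStep Lc) (smStep 3 Lc) S 1) (WPerfOf (sfStep Lc) (smStep 3 Lc) Wt 1))
        (((Lc ^ m : ℕ) : ℤ) • z) a b) m) μ ν = 0)
    {N Cg : ℝ}
    (hasym : ∀ m : ℕ, 1 ≤ m → |fPerfG Lc (sfStep Lc) (smStep 3 Lc) (GBm r Lc) (GBm r Lc) S Wt μ ν m - (m : ℝ) * stepBal N Lc| ≤ Cg) :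
    D1Drift Lc (JsBalBmNAtOf (d := 3) hLc hr cE cVH cΛ W Cw' δw hδw hW') N μ ν :=
  d1Drift_dressBmAt_of_slots_ward_symm_explicitDefect hr (JsBal0NAtOf (d := 3) hLc hr cE cVH cΛ W Cw' δw hδw hW') S Wt hLc2 hS1
    (fun j => (hW1 j).trans (JsBal0NAtOf_W hLc hr cE cVH cΛ W Cw' δw hδw hW' j).symm) hS hSall
    (fun j => by rw [JsBal0NAtOf_W]; exact hW j) (fun k j => by rw [JsBal0NAtOf_W, JsBal0NAtOf_W]; exact hWall k j)
    hδS hδW hθS0 hθS1 hθW0 hθW1 hSinf hWinf hWf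
    (hTsymm_JsBalBmNAtOf hLc hr cE cVH cΛ W Cw' δw hδw hW' (sfStep Lc) (smStep 3 Lc) (GBm r Lc) S Wt
      (Sfl := fun j => (JsBal0NAtOf (d := 3) hLc hr cE cVH cΛ W Cw' δw hδw hW' j).S) (fun _ => rfl) (GBm_one r Lc) hS1 hW1
      (hGinf_GBm_holds hLc2 hr 1 le_rfl) (hSinf 1 le_rfl) hWt hWsymm)
    μ ν hSDF hasym

/-- **THE CELL's END STATEMENT FROM ROAD «FP», PINNED AT THE FAMILY OF RECORD, K-SIDE AND `hTsymm` DISCHARGED**: `EndpointExistence Cn` BY TYPE from the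
hypotheses of `d1Drift_JsBalBmNAtOf_of_slots_ward_explicitDefect` + `hβ` (the one-loop split IS this family's `(μ,ν)` second moments) + (D4) `RemainderConst`
with `rr ≤ stepBal` + (C) + `hgen` (`OneStepKernelFamily.endpointExistence_of_D1Drift`).  NOT the continuum limit's construction; NOT BetaPertH. [our object] -/
theorem endpointExistence_JsBalBmNAtOf_of_slots_ward_explicitDefect (hLc2 : 2 ≤ Lc)
    (hS1 : ∀ j, S j 1 = (JsBal0NAtOf (d := 3) hLc hr cE cVH cΛ W Cw' δw hδw hW' j).S) (hW1 : ∀ j, Wt j 1 = W j)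
    (hS : ∀ j, LocStencil (unitS (sfStep Lc j) (smStep 3 Lc j) (JsBal0NAtOf (d := 3) hLc hr cE cVH cΛ W Cw' δw hδw hW' j).S) Cs δS)
    (hSall : ∀ k j, LocStencil (unitS (sfStep Lc (k + j)) (smStep 3 Lc (k + j))
        (JsBal0NAtOf (d := 3) hLc hr cE cVH cΛ W Cw' δw hδw hW' (k + j)).S -
      unitS (sfStep Lc k) (smStep 3 Lc k) (JsBal0NAtOf (d := 3) hLc hr cE cVH cΛ W Cw' δw hδw hW' k).S) (cS * θS ^ k) δS)
    (hW : ∀ j, VertexFamily₂ (unitW (sfStep Lc j) (smStep 3 Lc j) (W j)) Lc Cw δW)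
    (hWall : ∀ k j, VertexFamily₂ (unitW (sfStep Lc (k + j)) (smStep 3 Lc (k + j)) (W (k + j)) - unitW (sfStep Lc k) (smStep 3 Lc k) (W k)) Lc
      (cW * θW ^ k) δW)
    (hδS : 0 < δS) (hδW : 0 < δW) (hθS0 : 0 ≤ θS) (hθS1 : θS < 1) (hθW0 : 0 ≤ θW) (hθW1 : θW < 1)
    (hSinf : ∀ m : ℕ, 1 ≤ m → ∃ Cs' δS' : ℝ, 0 < δS' ∧ LocStencil (SPerfOf (sfStep Lc) (smStep 3 Lc) S m) Cs' δS')
    (hWinf : ∀ m : ℕ, 1 ≤ m → ∃ Cw'' δW' : ℝ, 0 < δW' ∧ VertexFamily₂ (WPerfOf (sfStep Lc) (smStep 3 Lc) Wt m) (Lc ^ m) Cw'' δW')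
    (hWf : WardTransversal (flipK (TGenOf Lc (KPerfOf (sfStep Lc) (smStep 3 Lc) (GBm r Lc) 1) (KPerfOf (sfStep Lc) (smStep 3 Lc) (GBm r Lc) 1)
      (SPerfOf (sfStep Lc) (smStep 3 Lc) S 1) (WPerfOf (sfStep Lc) (smStep 3 Lc) Wt 1))))
    (hWt : ∀ (j : ℕ) (μ : Fin (3 + 1)) (y : Fin (3 + 1) → ℤ) (ν : Fin (3 + 1)) (y' t : Fin (3 + 1) → ℤ),
      W j μ (y + t) ν (y' + t) = shiftK (-((Lc : ℤ) • t)) (W j μ y ν y'))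
    (hWsymm : ∀ (j : ℕ) (μ : Fin (3 + 1)) (y : Fin (3 + 1) → ℤ) (ν : Fin (3 + 1)) (y' : Fin (3 + 1) → ℤ), W j μ y ν y' = W j ν y' μ y)
    (μ ν : Fin 4)
    (hSDF : ∀ m : ℕ, 1 ≤ m → secondMoment (defect
      (fun m => TGenOf (Lc ^ m) (KPerfOf (sfStep Lc) (smStep 3 Lc) (GBm r Lc) m) (KPerfOf (sfStep Lc) (smStep 3 Lc) (GBm r Lc) m)
        (SPerfOf (sfStep Lc) (smStep 3 Lc) S m) (WPerfOf (sfStep Lc) (smStep 3 Lc) Wt m))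
      (fun m a b z => ((Lc ^ m : ℕ) : ℝ) ^ 8 * dressedEntry (colOf (KPerf (d := 3) Lc (sfStep Lc) (smStep 3 Lc) m))
        (TGenOf Lc (KPerfOf (sfStep Lc) (smStep 3 Lc) (GBm r Lc) 1) (KPerfOf (sfStep Lc) (smStep 3 Lc) (GBm r Lc) 1)
          (SPerfOf (sfStep Lc) (smStep 3 Lc) S 1) (WPerfOf (sfStep Lc) (smStep 3 Lc) Wt 1))
        (((Lc ^ m : ℕ) : ℤ) • z) a b) m) μ ν = 0)
    {N Cg : ℝ}
    (hasym : ∀ m : ℕ, 1 ≤ m → |fPerfG Lc (sfStep Lc) (smStep 3 Lc) (GBm r Lc) (GBm r Lc) S Wt μ ν m - (m : ℝ) * stepBal N Lc| ≤ Cg)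
    {β : HBeta} {Cn : B12.Construction} (hgen : ForwardGenerated Cn β) (Sβ : B12Beta.OneLoopSplit β)
    (hβ : ∀ j, Sβ.β0 j = B12Beta.secondMoment (TbalOf Lc (JsBalBmNAtOf (d := 3) hLc hr cE cVH cΛ W Cw' δw hδw hW') j) μ ν)
    {rr γ₀ : ℝ} (hγ₀ : 0 < γ₀) (hrem : RemainderConst Sβ γ₀ rr) (hr' : rr ≤ stepBal N Lc) (hcont : BetaContH γ₀ β) :
    EndpointExistence Cn :=
  endpointExistence_of_D1Drift hgen Sβ (JsBalBmNAtOf (d := 3) hLc hr cE cVH cΛ W Cw' δw hδw hW') hβ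
    (d1Drift_JsBalBmNAtOf_of_slots_ward_explicitDefect hLc hr cE cVH cΛ W Cw' δw hδw hW' S Wt hLc2 hS1 hW1 hS hSall hW hWall hδS hδW hθS0 hθS1
      hθW0 hθW1 hSinf hWinf hWf hWt hWsymm μ ν hSDF hasym) hγ₀ hrem hr' hcont

end Slots

/-! ## §4 The CENTRED-ROOT literal of an2's `hR` wirings (odd `Lc`, root `ctrOff 4 Lc`), adopted units, K-side and `hTsymm` discharged -/

section Centred

variable (cE cVH cΛ : ℝ) (W : ℕ → Fin (3 + 1) → (Fin (3 + 1) → ℤ) → Fin (3 + 1) → (Fin (3 + 1) → ℤ) → MKer (3 + 1) (Fib 3))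
  (Cw' δw : ℕ → ℝ) (hδw : ∀ j, 0 < δw j) (hW' : ∀ j, VertexFamily₂ (W j) Lc (Cw' j) (δw j))
  (S : ℕ → ℕ → Fin (3 + 1) → (Fin (3 + 1) → ℤ) → MKer (3 + 1) (Fib 3))
  (Wt : ℕ → ℕ → Fin (3 + 1) → (Fin (3 + 1) → ℤ) → Fin (3 + 1) → (Fin (3 + 1) → ℤ) → MKer (3 + 1) (Fib 3))
  {Cs cS δS θS Cw cW δW θW : ℝ}

/-- **ROAD «FP», THE END PINNED AT an2's CENTRED CO-DRESSED NATIVE SPINE** `JsBalBmNAtOf hLc.pos (ctrOff_mem_box hLc.pos) cE cVH cΛ W Cw δw hδw hW`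
(odd `Lc ≥ 3`, root `ctrOff 4 Lc` — LITERALLY the family of `SpineRootedBmNReduced.axisReflectionCovariant_flipK_TbalOf_JsBalBmNAtOf_ctrC_reduced` ∕
`…Assembly`), adopted units, resolvent families `G := GBm (ctrOff 4 Lc) Lc` (row BM-ROWS), the `m = 1` names `(coDressKBmAt (toSite (ctrOff 4 Lc)) Lc
(KInvStep Lc j), (JsBal0NAtOf … j).S, W j)`: residual EXACTLY {pins `hS1`∕`hW1`, S-rows on the rescaled native stencils, W-rows on the rescaled `W`, `hSinf`∕
`hWinf`, `hWf`, (Wt) `hWt` + bond-swap `hWsymm` of `W`, `hSDF`, `hasym`} — §3 at the centred root.  Discharges nothing of its own; NOT «D1 closed»,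
NOT BetaPertH. [our object] -/
theorem d1Drift_JsBalBmNAtOf_ctr_of_slots_ward_explicitDefect (hLc : Odd Lc) (hLc2 : 2 ≤ Lc)
    (hS1 : ∀ j, S j 1 = (JsBal0NAtOf (d := 3) hLc.pos (ctrOff_mem_box hLc.pos) cE cVH cΛ W Cw' δw hδw hW' j).S)
    (hW1 : ∀ j, Wt j 1 = W j)
    (hS : ∀ j, LocStencil (unitS (sfStep Lc j) (smStep 3 Lc j)
      (JsBal0NAtOf (d := 3) hLc.pos (ctrOff_mem_box hLc.pos) cE cVH cΛ W Cw' δw hδw hW' j).S) Cs δS)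
    (hSall : ∀ k j, LocStencil (unitS (sfStep Lc (k + j)) (smStep 3 Lc (k + j))
        (JsBal0NAtOf (d := 3) hLc.pos (ctrOff_mem_box hLc.pos) cE cVH cΛ W Cw' δw hδw hW' (k + j)).S -
      unitS (sfStep Lc k) (smStep 3 Lc k) (JsBal0NAtOf (d := 3) hLc.pos (ctrOff_mem_box hLc.pos) cE cVH cΛ W Cw' δw hδw hW' k).S) (cS * θS ^ k) δS)
    (hW : ∀ j, VertexFamily₂ (unitW (sfStep Lc j) (smStep 3 Lc j) (W j)) Lc Cw δW)
    (hWall : ∀ k j, VertexFamily₂ (unitW (sfStep Lc (k + j)) (smStep 3 Lc (k + j)) (W (k + j)) - unitW (sfStep Lc k) (smStep 3 Lc k) (W k)) Lc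
      (cW * θW ^ k) δW)
    (hδS : 0 < δS) (hδW : 0 < δW) (hθS0 : 0 ≤ θS) (hθS1 : θS < 1) (hθW0 : 0 ≤ θW) (hθW1 : θW < 1)
    (hSinf : ∀ m : ℕ, 1 ≤ m → ∃ Cs' δS' : ℝ, 0 < δS' ∧ LocStencil (SPerfOf (sfStep Lc) (smStep 3 Lc) S m) Cs' δS')
    (hWinf : ∀ m : ℕ, 1 ≤ m → ∃ Cw'' δW' : ℝ, 0 < δW' ∧ VertexFamily₂ (WPerfOf (sfStep Lc) (smStep 3 Lc) Wt m) (Lc ^ m) Cw'' δW')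
    (hWf : WardTransversal (flipK (TGenOf Lc (KPerfOf (sfStep Lc) (smStep 3 Lc) (GBm (ctrOff 4 Lc) Lc) 1)
      (KPerfOf (sfStep Lc) (smStep 3 Lc) (GBm (ctrOff 4 Lc) Lc) 1) (SPerfOf (sfStep Lc) (smStep 3 Lc) S 1) (WPerfOf (sfStep Lc) (smStep 3 Lc) Wt 1))))
    (hWt : ∀ (j : ℕ) (μ : Fin (3 + 1)) (y : Fin (3 + 1) → ℤ) (ν : Fin (3 + 1)) (y' t : Fin (3 + 1) → ℤ),
      W j μ (y + t) ν (y' + t) = shiftK (-((Lc : ℤ) • t)) (W j μ y ν y'))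
    (hWsymm : ∀ (j : ℕ) (μ : Fin (3 + 1)) (y : Fin (3 + 1) → ℤ) (ν : Fin (3 + 1)) (y' : Fin (3 + 1) → ℤ), W j μ y ν y' = W j ν y' μ y)
    (μ ν : Fin 4)
    (hSDF : ∀ m : ℕ, 1 ≤ m → secondMoment (defect
      (fun m => TGenOf (Lc ^ m) (KPerfOf (sfStep Lc) (smStep 3 Lc) (GBm (ctrOff 4 Lc) Lc) m)
        (KPerfOf (sfStep Lc) (smStep 3 Lc) (GBm (ctrOff 4 Lc) Lc) m) (SPerfOf (sfStep Lc) (smStep 3 Lc) S m) (WPerfOf (sfStep Lc) (smStep 3 Lc) Wt m))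
      (fun m a b z => ((Lc ^ m : ℕ) : ℝ) ^ 8 * dressedEntry (colOf (KPerf (d := 3) Lc (sfStep Lc) (smStep 3 Lc) m))
        (TGenOf Lc (KPerfOf (sfStep Lc) (smStep 3 Lc) (GBm (ctrOff 4 Lc) Lc) 1) (KPerfOf (sfStep Lc) (smStep 3 Lc) (GBm (ctrOff 4 Lc) Lc) 1)
          (SPerfOf (sfStep Lc) (smStep 3 Lc) S 1) (WPerfOf (sfStep Lc) (smStep 3 Lc) Wt 1))
        (((Lc ^ m : ℕ) : ℤ) • z) a b) m) μ ν = 0)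
    {N Cg : ℝ}
    (hasym : ∀ m : ℕ, 1 ≤ m →
      |fPerfG Lc (sfStep Lc) (smStep 3 Lc) (GBm (ctrOff 4 Lc) Lc) (GBm (ctrOff 4 Lc) Lc) S Wt μ ν m - (m : ℝ) * stepBal N Lc| ≤ Cg) :
    D1Drift Lc (JsBalBmNAtOf (d := 3) hLc.pos (ctrOff_mem_box hLc.pos) cE cVH cΛ W Cw' δw hδw hW') N μ ν :=
  d1Drift_JsBalBmNAtOf_of_slots_ward_explicitDefect hLc.pos (ctrOff_mem_box hLc.pos) cE cVH cΛ W Cw' δw hδw hW' S Wt hLc2 hS1 hW1 hS hSall hW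
    hWall hδS hδW hθS0 hθS1 hθW0 hθW1 hSinf hWinf hWf hWt hWsymm μ ν hSDF hasym

end Centred

end

end Summit.QuantumFields.BalabanUV.Beta.FP.RoadPinnedBmEnd
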